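import Summits.QuantumFields.YangMills.Theorems.BalabanUVNodesN11RunGuardIsCouplingFloor
import Literature.MathematicalPhysics.QuantumFieldTheory.Balaban1983to89.Node00.Record13CoPH

/-!
# DAG node N11 — AT K1's WITNESS θ₁₅ᶜᶜᴹᵂ(j; γ) THE NUMERICS WINDOW LIES ENTIRELY BELOW THE FLOOR WHEN `F.m ≤ 2j`: no run of positive length with couplings in `]0, e^{−(3L^j+8L+3)}]`
# (dag-n11-w3's γ₁₁ⁿᵘᵐ is below that) is partition-compatible at its last level — β-free; so the witness needs `2j + 1 ≤ F.m` for ANY compatible run in its window, and the families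
# with `F.m ≤ 2` have NO compatible positive-length run in the window of any witness `j ≥ 1`

HEADER — WORK-UNIT METADATA.  Cell `pub-ymgap`, YM-PLAN Track A (HUMAN RULING D-0062 ∕ D-0149 width seats), seat `pub-ymgap-dag-n11-w4` (g4; WIDTH SEAT 4 of 4 on NODE n11
[B14]), route `BalabanUVNodes` rev 27, deciding item K1⁸ `StabilityBRunRowsAtRecordR13SepCoPH` = stmt-QuantumFields-26907 (helper lane, `--kind proof --supports 26907 --as helper`,
count-neutral).  [III] = [Balaban1988Convergent], [I] = [Balaban1987RG1], [IV] = [Balaban1989LargeFieldI].  Over this seat's p615408 `…N11RunGuardIsCouplingFloor` (β-free threshold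
`not_partCompat₁₃_top_of_window_lt_threshold`: window `γ < e^{−L^{m−a}∕2}` at `K ≥ 1` ⇒ ¬`PartCompat₁₃`) and dag-n21-c's witness letters `theta13OfThm1CCMW_τ9_M ∕ _r` (`M = L^j`, `r = 1`).
Context (cited, not imported): dag-n11-w3 g3's p608030 `…N11NoExpansionNumericsAtThm1CCMW` (the K1 numerics window `γ₁₁ⁿᵘᵐ(L, j, N) = min(e^{−(3L^j+8L+3)}, (c∕4)²)`) and p610255
`…N11TopLevelRoomAtThm1CCMW` (LOCATED room `2j ≤ F.m` from the h3 row + the guard at the top level); g3's p608879 (volume floor `j + 1 ≤ F.m`).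

WHY THIS FILE.  The K1 lead chooses the witness parameter `j ≥ 1` per family `F`; dag-n11-w3 LOCATED that a windowed run can be partition-compatible at its last level together with the
numeric row h3 only if `2j ≤ F.m`.  THIS FILE closes the gap from the other side, β-free: if `F.m ≤ 2j` then `L^{m−j} ≤ L^j`, so `e^{−(3L^j+8L+3)} < e^{−L^{m−j}∕2}` and p615408's
threshold bites on the WHOLE numerics window — EVERY run of positive length whose couplings lie in `]0, e^{−(3L^j+8L+3)}]` fails `PartCompat₁₃` at its last level.  Hence (i) a compatible
run of positive length in the witness window needs `2j + 1 ≤ F.m` (so `j ≤ (F.m − 1)∕2`), and (ii) for the families with `F.m ≤ 2` (allowed by `T4Family`: `1 ≤ m`) EVERY witness `j ≥ 1`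
has its whole numerics window below the floor — there K1⁸ asks [III] Thm 1's conclusion for the record ONLY at runs excluded by print's p.257 (the one-block regime of p618164).
LOCATED, count-neutral; nothing registered is denied; the choice (restrict `F`, floor the window, or supply the one-block 𝐓-step) is the plan's ∕ K1 lead's.

WHAT THIS FILE PROVES (0 `sorry`, 0 `def`; elementary).  §1 `pow_sub_le_pow_of_le_two_mul` (`m ≤ 2j ⇒ L^{m−j} ≤ L^j`) · `exp_numerics_lt_threshold` (`1 ≤ L`, `m ≤ 2j` ⇒
`e^{−(3L^j+8L+3)} < e^{−L^{m−j}∕2}`).  §2 ★★ `not_partCompat₁₃_theta13OfThm1CCMW_top_of_numericsWindow` (at θ₁₅ᶜᶜᴹᵂ(j; γ…), `F.m ≤ 2j`: every run with `1 ≤ K` and couplings in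
`]0, γ′]`, `γ′ ≤ e^{−(3L^j+8L+3)}`, is NOT `PartCompat₁₃` at `K`) · ★★ `two_mul_add_one_le_m_of_partCompat₁₃_theta13OfThm1CCMW_top` (contrapositive: a compatible such run forces
`2j + 1 ≤ F.m`) · ★★ `not_partCompat₁₃_theta13OfThm1CCMW_top_of_m_le_two` (`F.m ≤ 2`, any `j ≥ 1`) · `_of_eq_theta13OfThm1CCMW` editions for H-extensions `θ.toStage13Params = θ₁₅ᶜᶜᴹᵂ`.

HONEST FRAMING.  Helper lane of K1⁸; count-neutral ℕ∕ℝ bookkeeping; nothing of Bałaban asserted; NOT a discharge, NOT a refutation.  N11 NOT discharged; K1⁸ NOT closed; counts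
unmoved (typed 28∕28 · discharged 5∕27).  R4 closes only the conditional finite-𝕋⁴ rung `BalabanLadder.UV` of one programme at fixed `ε = L^{−K}` — NOT ℝ⁴, NOT OS, NOT a mass gap, NOT
Clay.  No `sorry`, `axiom`, `def`, `instance`, `notation`.  Sources (SHAPE ∕ bookkeeping only): [III] (2.1) p.254, (2.5) p.255, p.257; [I] (0.1) p.251, Thm 1 p.259; [IV] (2.1) p.182.
-/

noncomputable section

namespace Summit.QuantumFields.YangMills.Theorems.BalabanUVNodesN11WitnessWindowBelowFloor

open Literature.MathematicalPhysics.QuantumFieldTheory.Balaban1983to89 T4Continuum Node00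
open BalabanUVNodesN11RunGuardIsCouplingFloor (not_partCompat₁₃_top_of_window_lt_threshold)

/-! ## §1  Arithmetic: `m ≤ 2j` puts the numerics window below the threshold -/

section Arith

/-- `m ≤ 2j ⇒ L^{m−j} ≤ L^j` (`1 ≤ L`). [cite: Balaban1987RG1, (0.1) p.251 (elementary)] -/
theorem pow_sub_le_pow_of_le_two_mul {L m j : ℕ} (hL : 1 ≤ L) (hm : m ≤ 2 * j) : L ^ (m - j) ≤ L ^ j :=
  Nat.pow_le_pow_right hL (by omega)

/-- **THE NUMERICS WINDOW IS BELOW THE THRESHOLD**: `1 ≤ L`, `m ≤ 2j` ⇒ `exp(−(3L^j + 8L + 3)) < exp(−L^{m−j}∕2)`. [cite: Balaban1987RG1, (0.1) p.251 (elementary)] -/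
theorem exp_numerics_lt_threshold {L m j : ℕ} (hL : 1 ≤ L) (hm : m ≤ 2 * j) :
    Real.exp (-(3 * (L : ℝ) ^ j + 8 * L + 3)) < Real.exp (-((L ^ (m - j) : ℕ) : ℝ) / 2) := by
  rw [Real.exp_lt_exp]
  have h1 : ((L ^ (m - j) : ℕ) : ℝ) ≤ (L : ℝ) ^ j := by exact_mod_cast pow_sub_le_pow_of_le_two_mul hL hm
  have h2 : (0 : ℝ) ≤ (L : ℝ) ^ j := by positivity
  have h3 : (0 : ℝ) ≤ L := by positivity
  linarith

end Arith

/-! ## §2  At the witness θ₁₅ᶜᶜᴹᵂ(j; γ): with `F.m ≤ 2j` no run of positive length in the numerics window is partition-compatible at its last level -/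

section Witness

variable (F : T4Family) (N : ℕ) [NeZero N] (j : ℕ) (γ ε₀ ε₂₉ B₃ B₃' a₀ a₁ : ℝ)

/-- **★★ BELOW THE FLOOR ON THE WHOLE NUMERICS WINDOW** (β-free): at θ₁₅ᶜᶜᴹᵂ(j; γ…) with `F.m ≤ 2j`, every run `p` with `1 ≤ p.K` whose couplings lie in `]0, γ′]`,
`γ′ ≤ exp(−(3L^j + 8L + 3))` (⊇ dag-n11-w3's `γ₁₁ⁿᵘᵐ(L, j, N)`), is NOT `PartCompat₁₃` at `p.K`. [cite: Balaban1988Convergent, (2.1) p.254, (2.5) p.255, p.257; Balaban1987RG1, Thm 1 p.259; Balaban1989LargeFieldI, (2.1) p.182] -/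
theorem not_partCompat₁₃_theta13OfThm1CCMW_top_of_numericsWindow (hm : F.m ≤ 2 * j) (p : B12.RunParams) (hK : 1 ≤ p.K) {γ' : ℝ}
    (hγ' : γ' ≤ Real.exp (-(3 * (F.L : ℝ) ^ j + 8 * F.L + 3)))
    (hW : Step.InInterval γ' p.K (gOfRecord₁₃ F N (theta13OfThm1CCMW F N j γ ε₀ ε₂₉ B₃ B₃' a₀ a₁) p)) :
    ¬ PartCompat₁₃ F N (theta13OfThm1CCMW F N j γ ε₀ ε₂₉ B₃ B₃' a₀ a₁) p p.K :=
  not_partCompat₁₃_top_of_window_lt_threshold (theta13OfThm1CCMW F N j γ ε₀ ε₂₉ B₃ B₃' a₀ a₁)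
    (theta13OfThm1CCMW_τ9_M F N j γ ε₀ ε₂₉ B₃ B₃' a₀ a₁) (theta13OfThm1CCMW_r F N j γ ε₀ ε₂₉ B₃ B₃' a₀ a₁) p hK hW
    (lt_of_le_of_lt hγ' (exp_numerics_lt_threshold (by have := F.hL11; omega) hm))

/-- **★★ A COMPATIBLE RUN IN THE NUMERICS WINDOW FORCES `2j + 1 ≤ F.m`** (contrapositive; sharpens dag-n11-w3's located room `2j ≤ F.m` by one, β-free and row-free).
[cite: Balaban1988Convergent, (2.1) p.254, (2.5) p.255, p.257; Balaban1987RG1, (0.1) p.251] -/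
theorem two_mul_add_one_le_m_of_partCompat₁₃_theta13OfThm1CCMW_top (p : B12.RunParams) (hK : 1 ≤ p.K) {γ' : ℝ}
    (hγ' : γ' ≤ Real.exp (-(3 * (F.L : ℝ) ^ j + 8 * F.L + 3)))
    (hW : Step.InInterval γ' p.K (gOfRecord₁₃ F N (theta13OfThm1CCMW F N j γ ε₀ ε₂₉ B₃ B₃' a₀ a₁) p))
    (h : PartCompat₁₃ F N (theta13OfThm1CCMW F N j γ ε₀ ε₂₉ B₃ B₃' a₀ a₁) p p.K) : 2 * j + 1 ≤ F.m := by
  by_contra hlt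
  exact not_partCompat₁₃_theta13OfThm1CCMW_top_of_numericsWindow F N j γ ε₀ ε₂₉ B₃ B₃' a₀ a₁ (by omega) p hK hγ' hW h

/-- **★★ THE FAMILIES WITH `F.m ≤ 2` ARE ENTIRELY BELOW THE FLOOR**: for `F.m ≤ 2` and ANY witness parameter `j ≥ 1`, no run of positive length in the numerics window is
partition-compatible at its last level. [cite: Balaban1988Convergent, (2.1) p.254, (2.5) p.255, p.257; Balaban1987RG1, (0.1) p.251 («m is a positive integer»)] -/
theorem not_partCompat₁₃_theta13OfThm1CCMW_top_of_m_le_two (hm2 : F.m ≤ 2) (hj : 1 ≤ j) (p : B12.RunParams) (hK : 1 ≤ p.K) {γ' : ℝ}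
    (hγ' : γ' ≤ Real.exp (-(3 * (F.L : ℝ) ^ j + 8 * F.L + 3)))
    (hW : Step.InInterval γ' p.K (gOfRecord₁₃ F N (theta13OfThm1CCMW F N j γ ε₀ ε₂₉ B₃ B₃' a₀ a₁) p)) :
    ¬ PartCompat₁₃ F N (theta13OfThm1CCMW F N j γ ε₀ ε₂₉ B₃ B₃' a₀ a₁) p p.K :=
  not_partCompat₁₃_theta13OfThm1CCMW_top_of_numericsWindow F N j γ ε₀ ε₂₉ B₃ B₃' a₀ a₁ (by omega) p hK hγ' hW

variable {F N}

/-- **THE SAME AT EVERY H-EXTENSION OF THE WITNESS** (`θ.toStage13Params = θ₁₅ᶜᶜᴹᵂ(j; γ…)`: K1's `gaussPinH` ∕ live re-pins): with `F.m ≤ 2j` no run of positive length in the numerics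
window is `PartCompat₁₃` at its last level. [cite: Balaban1988Convergent, (2.5) p.255, p.257; Balaban1989LargeFieldI, (2.1) p.182] -/
theorem not_partCompat₁₃_top_of_numericsWindow_of_eq_theta13OfThm1CCMW (θ : Stage13HParams F N)
    (hθ : θ.toStage13Params = theta13OfThm1CCMW F N j γ ε₀ ε₂₉ B₃ B₃' a₀ a₁) (hm : F.m ≤ 2 * j) (p : B12.RunParams) (hK : 1 ≤ p.K) {γ' : ℝ}
    (hγ' : γ' ≤ Real.exp (-(3 * (F.L : ℝ) ^ j + 8 * F.L + 3))) (hW : Step.InInterval γ' p.K (gOfRecord₁₃ F N θ.toStage13Params p)) :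
    ¬ PartCompat₁₃ F N θ.toStage13Params p p.K := by
  rw [hθ] at hW ⊢
  exact not_partCompat₁₃_theta13OfThm1CCMW_top_of_numericsWindow F N j γ ε₀ ε₂₉ B₃ B₃' a₀ a₁ hm p hK hγ' hW

end Witness

end Summit.QuantumFields.YangMills.Theorems.BalabanUVNodesN11WitnessWindowBelowFloor

end
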